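import Literature.AlgebraicGeometry.Modules.SerreTwistCharts
import HarnessLib

/-!
# Homogeneous Laurent polynomials with prescribed poles and their twisted evaluation on `Z ⊆ 𝐏ʳ_A`

Algebraic preliminaries for the comparison between the Čech complex of the twists `N(n)` of an
`𝒪_Z`-module (`Modules/SerreTwistMod`) and the algebraic Čech complexes `Č_d(K)` of graded modules over
`P = A[x₀, …, x_r]` of `Literature/Algebra/Homology/LaurentCech` (Serre's finiteness and vanishing
theorems in algebraic form, `Literature/Algebra/Homology/SerreVanishing`). For `ι : Z ⟶ 𝐏ʳ_A`:

* `SerreTwist.Adm s c ⊆ L` — the `A`-submodule of Laurent polynomials homogeneous of degree `c ∈ ℤ`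
  with poles only along `s` (`x_s^N v ∈ P`); `B_s = Adm s 0` (`LaurentCech.Bsub`); closure under products,
  under `x_t^N` (`xs_mem_Adm`) and under polynomials (`toL_mem_Adm`); the components of a vector of the
  localized degree-`d` piece `LaurentCech.locDeg e ⊤ s d` lie in `Adm s (d - e_j)` (`mem_Adm_of_mem_locDeg`);
* `SerreTwist.twB s i c v : B_{s ∪ {i}}` — the degree-zero fraction `v / x_i^c` of `v ∈ Adm s c`, additive
  and `A`-linear in `v`, multiplicative (`twB_mul`);
* `SerreTwist.twFun ι s i c v ∈ Γ(Z, Z_s ∩ Z_i)` — its value on `Z` (the tree's evaluation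
  `ProjCech.evalRing` on `Z_{s ∪ {i}} = Z_s ∩ Z_i`), with the **twisted cocycle identity**
  `twFun_cocycle`: `(v/x_i^c) (x_{i'}/x_i)^a = (x_{i'}/x_i)^b (v/x_{i'}^c)` on `V ⊆ Z_s ∩ Z_i ∩ Z_{i'}` for
  `b = a + c` — the identity making `i ↦ (v/x_i^c) · g_i` a section of the twist `N(b)` when `(g_i)_i` is one
  of `N(a)` — and the restriction rule `twFun_res` (`s ⊆ s'`).

References: Hartshorne II Prop. 5.11–5.15, III Thm. 5.2 (the graded module `Γ_*` and its Čech complex);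
EGA II 2.5. [Hartshorne1977]
-/

noncomputable section

universe u

open CategoryTheory AlgebraicGeometry TopologicalSpace Opposite
open Literature.Algebra.Homology Literature.Algebra.Homology.LaurentCech
open Literature.AlgebraicGeometry.Morphisms Literature.AlgebraicGeometry.Morphisms.ProjCech

attribute [local instance] MvPolynomial.gradedAlgebra
  Literature.AlgebraicGeometry.Motives.ProjBaseChange.algebraBase

namespace Literature.AlgebraicGeometry.Modules

namespace SerreTwist

variable {A : Type u} [CommRing A] {r : ℕ}

/-! ## Homogeneous Laurent polynomials with poles along `s` -/

variable (A r) in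
/-- **`Adm s c`**: the Laurent polynomials homogeneous of degree `c` with poles only along `s`, i.e.
`v ∈ L_c` with `x_s^N v ∈ P` for some `N` (the degree-`c` part of `P_{X_s}`; `Adm s 0 = B_s`). [folklore] -/
def Adm (s : Finset (Fin (r + 1))) (c : ℤ) : Submodule A (L A r) where
  carrier := {v | v ∈ Ldeg A r c ∧ ∃ (N : ℕ) (p : P A r), xs A s N * v = toL A r p}
  zero_mem' := ⟨Submodule.zero_mem _, 0, 0, by rw [mul_zero, map_zero]⟩
  add_mem' := by
    rintro v w ⟨hv, N, p, hp⟩ ⟨hw, N', p', hp'⟩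
    refine ⟨add_mem hv hw, N + N', Xs A s ^ N' * p + Xs A s ^ N * p', ?_⟩
    rw [map_add, map_mul, map_mul, toL_Xs_pow, toL_Xs_pow, ← hp, ← hp', Nat.cast_add, xs_add]
    ring
  smul_mem' := by
    rintro a v ⟨hv, N, p, hp⟩
    refine ⟨Submodule.smul_mem _ a hv, N, a • p, ?_⟩
    rw [mul_smul_comm, hp, map_smul]

/-- Membership in `Adm s c`. [folklore] -/
theorem mem_Adm {s : Finset (Fin (r + 1))} {c : ℤ} {v : L A r} :
    v ∈ Adm A r s c ↔ v ∈ Ldeg A r c ∧ ∃ (N : ℕ) (p : P A r), xs A s N * v = toL A r p := Iff.rfl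

/-- `B_s = Adm s 0`. [folklore] -/
theorem mem_Bsub_iff_mem_Adm {s : Finset (Fin (r + 1))} {v : L A r} : v ∈ Bsub A r s ↔ v ∈ Adm A r s 0 :=
  Iff.rfl

/-- `Adm s c ⊆ Adm t c` for `s ⊆ t`. [folklore] -/
theorem Adm_mono {s t : Finset (Fin (r + 1))} (hst : s ⊆ t) (c : ℤ) : Adm A r s c ≤ Adm A r t c := by
  rintro v ⟨hv, N, p, hp⟩
  refine ⟨hv, N, Xs A (t \ s) ^ N * p, ?_⟩
  rw [map_mul, toL_Xs_pow, ← hp, ← mul_assoc, ← xs_eq_sdiff_mul hst]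

/-- `Adm` is closed under products: `Adm s c · Adm s c' ⊆ Adm s (c + c')`. [folklore] -/
theorem mul_mem_Adm {s : Finset (Fin (r + 1))} {c c' : ℤ} {v w : L A r} (hv : v ∈ Adm A r s c)
    (hw : w ∈ Adm A r s c') : v * w ∈ Adm A r s (c + c') := by
  obtain ⟨hv, N, p, hp⟩ := hv
  obtain ⟨hw, N', p', hp'⟩ := hw
  refine ⟨mul_mem_Ldeg hv hw, N + N', p * p', ?_⟩
  rw [map_mul, ← hp, ← hp', Nat.cast_add, xs_add]
  ring

/-- `x_t^N ∈ Adm t (N #t)` for every `N ∈ ℤ`. [folklore] -/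
theorem xs_mem_Adm (t : Finset (Fin (r + 1))) (N : ℤ) : xs A t N ∈ Adm A r t (N * t.card) := by
  refine ⟨xs_mem_Ldeg t N, ?_⟩
  obtain ⟨n, rfl | rfl⟩ := Int.eq_nat_or_neg N
  · exact ⟨0, Xs A t ^ n, by rw [Nat.cast_zero, xs_zero, one_mul, toL_Xs_pow]⟩
  · exact ⟨n, 1, by rw [xs_mul_xs_neg, map_one]⟩

/-- `x_s^M` for `M ∈ ℕ` is a polynomial: it lies in `Adm t (M #s)` for EVERY `t`. [folklore] -/
theorem xs_natCast_mem_Adm (t s : Finset (Fin (r + 1))) (M : ℕ) : xs A s M ∈ Adm A r t (M * s.card) :=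
  ⟨xs_mem_Ldeg s M, 0, Xs A s ^ M, by rw [Nat.cast_zero, xs_zero, one_mul, toL_Xs_pow]⟩

/-- A homogeneous polynomial of degree `a` lies in `Adm s a`. [folklore] -/
theorem toL_mem_Adm (s : Finset (Fin (r + 1))) {p : P A r} {a : ℕ} (hp : p.IsHomogeneous a) :
    toL A r p ∈ Adm A r s a :=
  ⟨(toL_mem_Ldeg_iff p a).mpr hp, 0, p, by rw [Nat.cast_zero, xs_zero, one_mul]⟩

/-- A polynomial with `toL p ∈ L_c` lies in `Adm s c` (no poles). [folklore] -/
theorem toL_mem_Adm_of_mem_Ldeg (s : Finset (Fin (r + 1))) {p : P A r} {c : ℤ} (hp : toL A r p ∈ Ldeg A r c) :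
    toL A r p ∈ Adm A r s c :=
  ⟨hp, 0, p, by rw [Nat.cast_zero, xs_zero, one_mul]⟩

/-- `x_t^N · v ∈ Adm (s ∪ t) (N #t + c)` for `v ∈ Adm s c`. [folklore] -/
theorem xs_mul_mem_Adm {s : Finset (Fin (r + 1))} (t : Finset (Fin (r + 1))) (N : ℤ) {c : ℤ} {v : L A r}
    (hv : v ∈ Adm A r s c) : xs A t N * v ∈ Adm A r (s ∪ t) (N * t.card + c) :=
  mul_mem_Adm (Adm_mono Finset.subset_union_right _ (xs_mem_Adm t N)) (Adm_mono Finset.subset_union_left _ hv)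

/-- The components of a vector of the localized degree-`d` piece `(P^J_{X_s})_d` lie in `Adm s (d - e_j)`.
[folklore] -/
theorem mem_Adm_of_mem_locDeg {J : Type} (e : J → ℤ) {s : Finset (Fin (r + 1))} {d : ℤ} {v : J → L A r}
    (hv : v ∈ locDeg e (⊤ : Submodule (P A r) (J → P A r)) s d) (j : J) : v j ∈ Adm A r s (d - e j) := by
  obtain ⟨⟨N, k, -, hk⟩, hdeg⟩ := hv
  refine ⟨(mem_Kdeg e).mp hdeg j, N, k j, ?_⟩
  have := congr_fun hk j
  rwa [Pi.smul_apply, smul_eq_mul] at this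

/-! ## The degree-zero fraction `v / x_i^c ∈ B_{s ∪ {i}}` -/

/-- `v / x_i^c ∈ Adm (s ∪ {i}) 0 = B_{s ∪ {i}}` for `v ∈ Adm s c`. [folklore] -/
theorem xs_neg_mul_mem_Bsub {s : Finset (Fin (r + 1))} (i : Fin (r + 1)) {c : ℤ} {v : L A r}
    (hv : v ∈ Adm A r s c) : xs A {i} (-c) * v ∈ Bsub A r (s ∪ {i}) := by
  have h := xs_mul_mem_Adm {i} (-c) hv
  rwa [Finset.card_singleton, Nat.cast_one, mul_one, neg_add_cancel] at h

/-- **The fraction `v / x_i^c` as an element of `B_{s ∪ {i}}`.** [folklore] -/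
def twB (s : Finset (Fin (r + 1))) (i : Fin (r + 1)) (c : ℤ) (v : L A r) (hv : v ∈ Adm A r s c) :
    Bsub A r (s ∪ {i}) :=
  ⟨xs A {i} (-c) * v, xs_neg_mul_mem_Bsub i hv⟩

/-- The underlying Laurent polynomial of `twB`. [folklore] -/
@[simp]
theorem coe_twB (s : Finset (Fin (r + 1))) (i : Fin (r + 1)) (c : ℤ) (v : L A r) (hv : v ∈ Adm A r s c) :
    (twB s i c v hv : L A r) = xs A {i} (-c) * v := rfl

/-- `twB` is additive in `v`. [folklore] -/
theorem twB_add (s : Finset (Fin (r + 1))) (i : Fin (r + 1)) (c : ℤ) (v w : L A r) (hv : v ∈ Adm A r s c)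
    (hw : w ∈ Adm A r s c) : twB s i c (v + w) (add_mem hv hw) = twB s i c v hv + twB s i c w hw :=
  Subtype.ext (mul_add _ _ _)

/-- `twB` is `A`-linear in `v`. [folklore] -/
theorem twB_smul (s : Finset (Fin (r + 1))) (i : Fin (r + 1)) (c : ℤ) (a : A) (v : L A r)
    (hv : v ∈ Adm A r s c) : twB s i c (a • v) (Submodule.smul_mem _ a hv) = a • twB s i c v hv :=
  Subtype.ext (mul_smul_comm a _ v)

/-- `twB` of zero. [folklore] -/
theorem twB_zero (s : Finset (Fin (r + 1))) (i : Fin (r + 1)) (c : ℤ) :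
    twB s i c (0 : L A r) (Submodule.zero_mem _) = 0 :=
  Subtype.ext (mul_zero _)

/-- Proof irrelevance / congruence for `twB`. [folklore] -/
theorem twB_congr (s : Finset (Fin (r + 1))) (i : Fin (r + 1)) (c : ℤ) {v w : L A r} (h : v = w)
    (hv : v ∈ Adm A r s c) (hw : w ∈ Adm A r s c) : twB s i c v hv = twB s i c w hw := by
  subst h; rfl

/-- **`twB` is multiplicative**: `(v w) / x_i^{c + c'} = (v / x_i^c) (w / x_i^{c'})`. [folklore] -/
theorem twB_mul (s : Finset (Fin (r + 1))) (i : Fin (r + 1)) (c c' : ℤ) (v w : L A r) (hv : v ∈ Adm A r s c)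
    (hw : w ∈ Adm A r s c') :
    twB s i (c + c') (v * w) (mul_mem_Adm hv hw) = twB s i c v hv * twB s i c' w hw := by
  apply Subtype.ext
  change xs A {i} (-(c + c')) * (v * w) = xs A {i} (-c) * v * (xs A {i} (-c') * w)
  rw [neg_add, xs_add]
  ring

/-- The fraction `x_s^N / x_i^{N #s}` is invertible in `B_{s ∪ {i}}` (inverse `x_i^{N #s} / x_s^N`). [folklore] -/
theorem isUnit_twB_xs (s : Finset (Fin (r + 1))) (i : Fin (r + 1)) (N : ℤ) :
    IsUnit (twB s i (N * s.card) (xs A s N) (xs_mem_Adm (A := A) s N)) := by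
  have hmem : xs A {i} (N * s.card) * xs A s (-N) ∈ Bsub A r (s ∪ {i}) := by
    have h := xs_mul_mem_Adm (s := s) {i} (N * s.card) (xs_mem_Adm (A := A) s (-N))
    rw [Finset.card_singleton, Nat.cast_one, mul_one, neg_mul, add_neg_cancel] at h
    exact h
  refine IsUnit.of_mul_eq_one ⟨_, hmem⟩ (Subtype.ext ?_)
  change xs A {i} (-(N * s.card)) * xs A s N * (xs A {i} (N * s.card) * xs A s (-N)) = 1
  calc xs A {i} (-(N * s.card)) * xs A s N * (xs A {i} (N * s.card) * xs A s (-N))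
      = (xs A {i} (-(N * s.card)) * xs A {i} (N * s.card)) * (xs A s N * xs A s (-N)) := by ring
    _ = 1 := by rw [xs_neg_mul_xs, xs_mul_xs_neg, one_mul]

/-! ## Evaluation on `Z`: the twisted chart functions `v / x_i^c ∈ Γ(Z, Z_s ∩ Z_i)` -/

variable {Z : Scheme.{u}} (ι : Z ⟶ PP A r)

/-- `Z_s ∩ Z_i ⊆ Z_{s ∪ {i}}` (an equality, `Zop_union`). [folklore] -/
theorem inf_le_Zop_union (s : Finset (Fin (r + 1))) (i : Fin (r + 1)) : Zop ι s ⊓ Zop ι {i} ≤ Zop ι (s ∪ {i}) :=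
  (Zop_union ι s {i}).symm.le

/-- **The twisted chart function `v / x_i^c ∈ Γ(Z, Z_s ∩ Z_i)`** of `v ∈ Adm s c`. [folklore] -/
def twFun (s : Finset (Fin (r + 1))) (i : Fin (r + 1)) (c : ℤ) (v : L A r) (hv : v ∈ Adm A r s c) :
    Γ(Z, Zop ι s ⊓ Zop ι {i}) :=
  show Sections (strZ ι) (Zop ι s ⊓ Zop ι {i}) from
    Sections.res (strZ ι) (inf_le_Zop_union ι s i) (evalRing ι (s ∪ {i}) (twB s i c v hv))

/-- `twFun` in the `Sections` language. [folklore] -/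
theorem twFun_def (s : Finset (Fin (r + 1))) (i : Fin (r + 1)) (c : ℤ) (v : L A r) (hv : v ∈ Adm A r s c) :
    (show Sections (strZ ι) (Zop ι s ⊓ Zop ι {i}) from twFun ι s i c v hv) =
      Sections.res (strZ ι) (inf_le_Zop_union ι s i) (evalRing ι (s ∪ {i}) (twB s i c v hv)) := rfl

/-- `twFun` is additive in `v`. [folklore] -/
theorem twFun_add (s : Finset (Fin (r + 1))) (i : Fin (r + 1)) (c : ℤ) (v w : L A r) (hv : v ∈ Adm A r s c)
    (hw : w ∈ Adm A r s c) :
    twFun ι s i c (v + w) (add_mem hv hw) = twFun ι s i c v hv + twFun ι s i c w hw := by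
  change Sections.res (strZ ι) (inf_le_Zop_union ι s i) (evalRing ι (s ∪ {i}) (twB s i c (v + w) (add_mem hv hw))) =
    Sections.res (strZ ι) (inf_le_Zop_union ι s i) (evalRing ι (s ∪ {i}) (twB s i c v hv)) +
      Sections.res (strZ ι) (inf_le_Zop_union ι s i) (evalRing ι (s ∪ {i}) (twB s i c w hw))
  rw [twB_add, map_add, map_add]

/-- `twFun` of zero. [folklore] -/
theorem twFun_zero (s : Finset (Fin (r + 1))) (i : Fin (r + 1)) (c : ℤ) :
    twFun ι s i c (0 : L A r) (Submodule.zero_mem _) = 0 := by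
  change Sections.res (strZ ι) (inf_le_Zop_union ι s i) (evalRing ι (s ∪ {i}) (twB s i c 0 (Submodule.zero_mem _))) = 0
  rw [twB_zero, map_zero, map_zero]

/-- `twFun` is `A`-linear in `v`: `(a v)/x_i^c = a · (v / x_i^c)` with `a` acting through
`A → Γ(Z, 𝒪_Z)`. [folklore] -/
theorem twFun_smul (s : Finset (Fin (r + 1))) (i : Fin (r + 1)) (c : ℤ) (a : A) (v : L A r)
    (hv : v ∈ Adm A r s c) :
    twFun ι s i c (a • v) (Submodule.smul_mem _ a hv) =
      Z.presheaf.map (homOfLE (le_top : Zop ι s ⊓ Zop ι {i} ≤ ⊤)).op (algebraMapΓ (strZ ι) a) *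
        twFun ι s i c v hv := by
  have hne : (s ∪ {i} : Finset (Fin (r + 1))).Nonempty := ⟨i, Finset.mem_union_right _ (Finset.mem_singleton_self i)⟩
  change Sections.res (strZ ι) (inf_le_Zop_union ι s i)
      (evalAlg ι (s ∪ {i}) hne (twB s i c (a • v) (Submodule.smul_mem _ a hv))) =
    algebraMap A (Sections (strZ ι) (Zop ι s ⊓ Zop ι {i})) a *
      Sections.res (strZ ι) (inf_le_Zop_union ι s i) (evalAlg ι (s ∪ {i}) hne (twB s i c v hv))
  rw [twB_smul, map_smul, map_smul, Algebra.smul_def]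

/-- Congruence for `twFun` in the Laurent polynomial. [folklore] -/
theorem twFun_congr (s : Finset (Fin (r + 1))) (i : Fin (r + 1)) (c : ℤ) {v w : L A r} (h : v = w)
    (hv : v ∈ Adm A r s c) (hw : w ∈ Adm A r s c) : twFun ι s i c v hv = twFun ι s i c w hw := by
  subst h; rfl

/-- Congruence for `twFun` in the degree. [folklore] -/
theorem twFun_congr_deg (s : Finset (Fin (r + 1))) (i : Fin (r + 1)) {c c' : ℤ} (h : c = c') (v : L A r)
    (hv : v ∈ Adm A r s c) (hv' : v ∈ Adm A r s c') : twFun ι s i c v hv = twFun ι s i c' v hv' := by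
  subst h; rfl

/-- **Restriction to a larger chart set**: every restriction of `twFun` to `V ⊆ Z_t`, `s ∪ {i} ⊆ t`, is the
restriction of the evaluation over `Z_t` of the same fraction. [folklore] -/
theorem map_twFun_eq (s : Finset (Fin (r + 1))) (i : Fin (r + 1)) (c : ℤ) (v : L A r) (hv : v ∈ Adm A r s c)
    {t : Finset (Fin (r + 1))} (ht : s ∪ {i} ⊆ t) {V : Z.Opens} (hV : V ≤ Zop ι s ⊓ Zop ι {i}) (hVt : V ≤ Zop ι t) :
    Z.presheaf.map (homOfLE hV).op (twFun ι s i c v hv) =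
      Sections.res (strZ ι) hVt (evalRing ι t ⟨xs A {i} (-c) * v, Bsub_mono ht (xs_neg_mul_mem_Bsub i hv)⟩) := by
  have e := evalRing_res ι ht (twB s i c v hv)
  change Sections.res (strZ ι) hV (Sections.res (strZ ι) _ (evalRing ι (s ∪ {i}) (twB s i c v hv))) = _
  rw [Sections.res_res]
  change _ = Sections.res (strZ ι) hVt (evalRing ι t ⟨(twB s i c v hv : L A r), Bsub_mono ht (twB s i c v hv).2⟩)
  rw [e, Sections.res_res]

/-- **Restriction rule**: for `s ⊆ s'`, `twFun s' i c v` is the restriction of `twFun s i c v`. [folklore] -/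
theorem twFun_res {s s' : Finset (Fin (r + 1))} (hss' : s ⊆ s') (i : Fin (r + 1)) (c : ℤ) (v : L A r)
    (hv : v ∈ Adm A r s c) :
    twFun ι s' i c v (Adm_mono hss' c hv) =
      Z.presheaf.map (homOfLE (inf_le_inf_right (Zop ι {i}) (Zop_mono ι hss'))).op (twFun ι s i c v hv) := by
  have ht : s ∪ {i} ⊆ s' ∪ {i} := Finset.union_subset_union hss' le_rfl
  rw [map_twFun_eq ι s i c v hv ht _ (inf_le_Zop_union ι s' i)]
  rfl

/-- **Multiplicativity on `Z`**: `(v w)/x_i^{c+c'} = (v/x_i^c) (w/x_i^{c'})`. [folklore] -/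
theorem twFun_mul (s : Finset (Fin (r + 1))) (i : Fin (r + 1)) (c c' : ℤ) (v w : L A r) (hv : v ∈ Adm A r s c)
    (hw : w ∈ Adm A r s c') :
    twFun ι s i (c + c') (v * w) (mul_mem_Adm hv hw) = twFun ι s i c v hv * twFun ι s i c' w hw := by
  change Sections.res (strZ ι) (inf_le_Zop_union ι s i) (evalRing ι (s ∪ {i}) (twB s i (c + c') (v * w) (mul_mem_Adm hv hw))) =
    Sections.res (strZ ι) (inf_le_Zop_union ι s i) (evalRing ι (s ∪ {i}) (twB s i c v hv)) *
      Sections.res (strZ ι) (inf_le_Zop_union ι s i) (evalRing ι (s ∪ {i}) (twB s i c' w hw))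
  rw [twB_mul, map_mul, map_mul]

/-- A degree-zero fraction of `B_{s ∪ {i}}` that is a unit evaluates to a unit on `Z_s ∩ Z_i`; in particular
`x_s^N / x_i^{N #s}` does. [folklore] -/
theorem isUnit_twFun_xs (s : Finset (Fin (r + 1))) (i : Fin (r + 1)) (N : ℤ) :
    IsUnit (twFun ι s i (N * s.card) (xs A s N) (xs_mem_Adm s N)) := by
  change IsUnit (Sections.res (strZ ι) _ (evalRing ι (s ∪ {i}) (twB s i (N * s.card) (xs A s N) _)))
  exact ((isUnit_twB_xs s i N).map _).map _

/-- **Degree zero**: for `b ∈ B_s = Adm s 0`, `twFun s i 0 b` is the restriction of the value of `b` on `Z_s`.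
[folklore] -/
theorem twFun_zero_deg (s : Finset (Fin (r + 1))) (i : Fin (r + 1)) (b : Bsub A r s) :
    twFun ι s i 0 (b : L A r) b.2 =
      Z.presheaf.map (homOfLE (inf_le_left : Zop ι s ⊓ Zop ι {i} ≤ Zop ι s)).op
        (show Γ(Z, Zop ι s) from evalRing ι s b) := by
  have hb : twB s i 0 (b : L A r) b.2 = ⟨(b : L A r), Bsub_mono Finset.subset_union_left b.2⟩ := by
    apply Subtype.ext
    change xs A {i} (-0) * (b : L A r) = b
    rw [neg_zero, xs_zero, one_mul]
  change Sections.res (strZ ι) (inf_le_Zop_union ι s i) (evalRing ι (s ∪ {i}) (twB s i 0 (b : L A r) b.2)) =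
    Sections.res (strZ ι) inf_le_left (evalRing ι s b)
  rw [hb, evalRing_res ι Finset.subset_union_left b, Sections.res_res]

/-- `x_i^c / x_i^c = 1`: `twFun s i c (x_i^c) = 1` (for `i ∈ s`, so that `x_i^c ∈ Adm s c`). [folklore] -/
theorem twFun_xs_single_self (s : Finset (Fin (r + 1))) (i : Fin (r + 1)) (c : ℤ) (h : xs A {i} c ∈ Adm A r s c) :
    twFun ι s i c (xs A {i} c) h = 1 := by
  have hb : twB s i c (xs A {i} c) h = 1 := by
    apply Subtype.ext
    change xs A {i} (-c) * xs A {i} c = 1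
    rw [xs_neg_mul_xs]
  change Sections.res (strZ ι) (inf_le_Zop_union ι s i) (evalRing ι (s ∪ {i}) (twB s i c (xs A {i} c) h)) = 1
  rw [hb, map_one, map_one]

/-- `x_i^c ∈ Adm s c` for `i ∈ s`. [folklore] -/
theorem xs_single_mem_Adm {s : Finset (Fin (r + 1))} {i : Fin (r + 1)} (hi : i ∈ s) (c : ℤ) :
    xs A {i} c ∈ Adm A r s c := by
  have h := xs_mem_Adm (A := A) ({i} : Finset (Fin (r + 1))) c
  rw [Finset.card_singleton, Nat.cast_one, mul_one] at h
  exact Adm_mono (Finset.singleton_subset_iff.mpr hi) c h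

/-! ## The twisted cocycle identity -/

omit ι in
/-- In the Laurent ring: `x_i^{-c} (x_{i'} x_i^{-1})^a = (x_{i'} x_i^{-1})^b x_{i'}^{-c}` for `b = a + c`.
[folklore] -/
theorem xs_twist_identity (i i' : Fin (r + 1)) {a b : ℕ} {c : ℤ} (h : (b : ℤ) = a + c) (v : L A r) :
    xs A {i} (-c) * v * (xs A {i'} 1 * xs A {i} (-1)) ^ a =
      (xs A {i'} 1 * xs A {i} (-1)) ^ b * (xs A {i'} (-c) * v) := by
  rw [mul_pow, mul_pow, xs_pow, xs_pow, xs_pow, xs_pow, mul_one, mul_one, mul_neg_one, mul_neg_one]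
  have h1 : xs A {i} (-c) * xs A {i} (-(a : ℤ)) = xs A {i} (-(b : ℤ)) := by
    rw [← xs_add]; congr 1; omega
  have h2 : xs A {i'} (b : ℤ) * xs A {i'} (-c) = xs A {i'} (a : ℤ) := by
    rw [← xs_add]; congr 1; omega
  calc xs A {i} (-c) * v * (xs A {i'} (a : ℤ) * xs A {i} (-(a : ℤ)))
      = xs A {i'} (a : ℤ) * (xs A {i} (-c) * xs A {i} (-(a : ℤ))) * v := by ring
    _ = (xs A {i'} (b : ℤ) * xs A {i'} (-c)) * xs A {i} (-(b : ℤ)) * v := by rw [h1, h2]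
    _ = _ := by ring

/-- **The twisted cocycle identity on `Z`**: for `v ∈ Adm s c`, `b = a + c` and `V ⊆ Z_s ∩ Z_i ∩ Z_{i'}`,
`(v/x_i^c)|_V · (x_{i'}/x_i)|_V^a = (x_{i'}/x_i)|_V^b · (v/x_{i'}^c)|_V`. [folklore] -/
theorem twFun_cocycle (s : Finset (Fin (r + 1))) (i i' : Fin (r + 1)) {a b : ℕ} {c : ℤ} (h : (b : ℤ) = a + c)
    (v : L A r) (hv : v ∈ Adm A r s c) {V : Z.Opens} (hVi : V ≤ Zop ι s ⊓ Zop ι {i})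
    (hVi' : V ≤ Zop ι s ⊓ Zop ι {i'}) :
    Z.presheaf.map (homOfLE hVi).op (twFun ι s i c v hv) *
        Z.presheaf.map (homOfLE (hVi.trans inf_le_right)).op (chartFun ι i' i) ^ a =
      Z.presheaf.map (homOfLE (hVi.trans inf_le_right)).op (chartFun ι i' i) ^ b *
        Z.presheaf.map (homOfLE hVi').op (twFun ι s i' c v hv) := by
  -- everything is the restriction of an evaluation over `Z_T`, `T = s ∪ {i} ∪ {i'}`
  have hT : V ≤ Zop ι (s ∪ {i} ∪ {i'}) := le_Zop_union ι (le_Zop_union ι (hVi.trans inf_le_left) (hVi.trans inf_le_right))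
    (hVi'.trans inf_le_right)
  have h₁ : s ∪ {i} ⊆ s ∪ {i} ∪ {i'} := Finset.subset_union_left
  have h₂ : s ∪ {i'} ⊆ s ∪ {i} ∪ {i'} :=
    Finset.union_subset (Finset.subset_union_left.trans Finset.subset_union_left) Finset.subset_union_right
  have h₃ : ({i} : Finset (Fin (r + 1))) ⊆ s ∪ {i} ∪ {i'} := Finset.subset_union_right.trans Finset.subset_union_left
  have hc : Z.presheaf.map (homOfLE (hVi.trans inf_le_right)).op (chartFun ι i' i) =
      Sections.res (strZ ι) hT (evalRing ι _ ⟨tEl A {i'} i, Bsub_mono h₃ (tEl_mem {i'} i)⟩) :=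
    res_chartFun_eq ι h₃ (hVi.trans inf_le_right) hT
  have key : Sections.res (strZ ι) hT (evalRing ι _ ⟨xs A {i} (-c) * v, Bsub_mono h₁ (xs_neg_mul_mem_Bsub i hv)⟩) *
      Sections.res (strZ ι) hT (evalRing ι _ ⟨tEl A {i'} i, Bsub_mono h₃ (tEl_mem {i'} i)⟩) ^ a =
      Sections.res (strZ ι) hT (evalRing ι _ ⟨tEl A {i'} i, Bsub_mono h₃ (tEl_mem {i'} i)⟩) ^ b *
        Sections.res (strZ ι) hT (evalRing ι _ ⟨xs A {i'} (-c) * v, Bsub_mono h₂ (xs_neg_mul_mem_Bsub i' hv)⟩) := by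
    rw [← map_pow, ← map_pow, ← map_mul, ← map_mul, ← map_pow, ← map_pow, ← map_mul, ← map_mul]
    congr 2
    apply Subtype.ext
    change xs A {i} (-c) * v * tEl A {i'} i ^ a = tEl A {i'} i ^ b * (xs A {i'} (-c) * v)
    rw [tEl_singleton]
    exact xs_twist_identity i i' h v
  rw [map_twFun_eq ι s i c v hv h₁ hVi hT, map_twFun_eq ι s i' c v hv h₂ hVi' hT, hc]
  exact key

end SerreTwist

end Literature.AlgebraicGeometry.Modules

end
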